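import Summits.QuantumFields.YangMills.Theorems.TwistedTraceScaling.Negative.InvCouplingFormGuard
import HarnessLib

/-!
# The weak-coupling guard of LIM ∕ X-FORM is EXACTLY the exclusion of `β → 0⁺`: every fixed positive cut `c ≤ β` gives the same statement,
# the cut `0 < β` gives a false one — crux disprover, cycle 63 (route `LuscherReduction`, crux `TwistedTraceScaling` stmt-QuantumFields-20203;
# `--supports`, helper only)

R75b ∕ R75c ∕ R77 showed that the guard `1 ≤ β` of LIM (⟺ `TwoLattice.Stmt.stub_cmpTwoLoop`, R75) and of its X-FORM (R76) is load-bearing: deleting it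
lets the text quantify over the STRONG root of the two-loop label (`1/ḡ²(β, L) = β/2 − 2b₀ log L + (b₁/b₀) log(2b₀/β) → +∞` as `β → 0⁺`).  This file makes
the role of the guard exact (regime (bj)(ii) of the disprover's work file, previously untyped):

* `invRunningCoupling_le_of_cut` — on a bounded bare-coupling range `c₂ ≤ β ≤ c₁` (`0 < c₂`) the inverse running coupling is bounded ABOVE uniformly in
  `L ≥ 1`: `1/ḡ²(β, L) ≤ c₁/2 + (b₁/b₀) log(2b₀/c₂)` — so a large threshold `X0` never sees such `β`.
* ★ `invCouplingForm_cut_mono` ∕ `invCouplingForm_cut_iff` — for ANY two cuts `0 < c₁, c₂` the X-FORMs with guard `c₁ ≤ β` and with guard `c₂ ≤ β` are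
  EQUIVALENT (enlarge the threshold past the bound above); in particular `X-FORM[c ≤ β] ⟺ X-FORM[1 ≤ β]` for every `c > 0`.
* ★ `labelLimit_cut_iff` — the same for LIM (`LIM[c ≤ β] ⟺ LIM`, every `c > 0`; through the cut-generic conversion `labelLimit_iff_invCouplingForm_cut`), and
  `cmpTwoLoop_iff_labelLimit_cut ∕ cmpTwoLoop_iff_invCouplingForm_cut` — the registered stub ⟺ LIM ∕ X-FORM with ANY fixed positive cut.
* ★ `invCouplingForm_false_posCut` ∕ `labelLimit_false_posCut` — with the cut `0 < β` (no fixed floor) both texts are FALSE (the strong root of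
  ✓`R75c.strongRoot_violates` has `0 < β < 1`).
DICHOTOMY for a rev 4: guard `c ≤ β` with a FIXED `c > 0` — admissible, same content as the registered stub (certificate below); guard `0 < β`, `0 ≤ β` or none —
refuted as it stands.  The number `1` in `1 ≤ β` carries no content.

HONEST FRAMING: guard/robustness facts about a hypothesis text equivalent to an OPEN stub of a child of the CONDITIONAL reduction route R2b1; the crux
`TwistedTraceScaling` is NOT refuted and NOT closed; fixed-lattice statements only — not infinite volume, not a mass gap, not Clay.  No definitions, no `sorry`.
-/

set_option autoImplicit false

noncomputable section

open MeasureTheory Filter Topology Real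
open Literature.MathematicalPhysics.QuantumFieldTheory hiding SU2
open Literature.MathematicalPhysics.QuantumLattice
open Literature.Analysis.OperatorTheory.YMMatrixModel
open scoped BigOperators

namespace Summit.QuantumFields.YangMills.Theorems.TwistedTraceScaling.Negative

open Summit.QuantumFields.YangMills.Theorems.FemtoTransferGap
open Summit.QuantumFields.YangMills.Theorems.FemtoTransferGap.TraceDoor
open Summit.QuantumFields.YangMills.Theorems.FemtoTransferGap.TT
open Summit.QuantumFields.YangMills.Theorems.FemtoTransferGap.TwoLattice

namespace R78

/-! ## §1 On a bounded bare-coupling range the inverse running coupling is bounded above, uniformly in `L` -/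

/-- `c₂ ≤ β ≤ c₁`, `0 < c₂`, `L ≥ 1` ⟹ `1/ḡ²(β, L) ≤ c₁/2 + (b₁/b₀) log(2b₀/c₂)` (✓`BOHandover.invRunningCoupling_eq`; `−2b₀ log L ≤ 0`, `log(2b₀/β) ≤ log(2b₀/c₂)`).
[cite: LuscherMunster1984, §2] -/
theorem invRunningCoupling_le_of_cut {c₁ c₂ β : ℝ} (hc₂ : 0 < c₂) (h₂ : c₂ ≤ β) (h₁ : β ≤ c₁) (L : ℕ) [NeZero L] :
    invRunningCoupling β L ≤ c₁ / 2 + (b1 / b0) * Real.log (2 * b0 / c₂) := by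
  rw [BOHandover.invRunningCoupling_eq]
  have hb0 : 0 < b0 := by unfold b0; positivity
  have hb1 : 0 < b1 := by unfold b1; positivity
  have hβ : 0 < β := lt_of_lt_of_le hc₂ h₂
  have hlogL : 0 ≤ Real.log (L : ℝ) := Real.log_nonneg (by exact_mod_cast NeZero.one_le)
  have hlog : Real.log (2 * b0 / β) ≤ Real.log (2 * b0 / c₂) :=
    Real.log_le_log (by positivity) (div_le_div_of_nonneg_left (by positivity) hc₂ h₂)
  have h1 : 0 ≤ 2 * b0 * Real.log (L : ℝ) := by positivity
  have h2 : (b1 / b0) * Real.log (2 * b0 / β) ≤ (b1 / b0) * Real.log (2 * b0 / c₂) :=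
    mul_le_mul_of_nonneg_left hlog (div_pos hb1 hb0).le
  linarith

/-! ## §2 ★ X-FORM: any two fixed positive cuts give the same statement -/

/-- ★ **Cut monotonicity (in fact cut-independence) of the X-FORM.**  For any `0 < c₁` and `0 < c₂`: the X-FORM with guard `c₁ ≤ β` implies the X-FORM with guard
`c₂ ≤ β` — enlarge the threshold to `max X0 (c₁/2 + (b₁/b₀) log(2b₀/c₂) + 1)`; a `β ∈ [c₂, c₁)` then cannot satisfy `X0' ≤ 1/ḡ²(β, L)` (§1), and a `β ≥ c₁` is covered
by the hypothesis. [folklore] -/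
theorem invCouplingForm_cut_mono {c₁ c₂ : ℝ} (hc₂ : 0 < c₂)
    (h : ∀ s : ℝ, 0 < s → ∀ ε : ℝ, 0 < ε → ∃ X0 : ℝ, 0 < X0 ∧
      ∀ (L : ℕ) [NeZero L], ∀ β : ℝ, c₁ ≤ β → X0 ≤ invRunningCoupling β L →
        |traceRatio L β (femtoSteps s β L) - hTraceRatio s| ≤ ε) :
    ∀ s : ℝ, 0 < s → ∀ ε : ℝ, 0 < ε → ∃ X0 : ℝ, 0 < X0 ∧
      ∀ (L : ℕ) [NeZero L], ∀ β : ℝ, c₂ ≤ β → X0 ≤ invRunningCoupling β L →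
        |traceRatio L β (femtoSteps s β L) - hTraceRatio s| ≤ ε := by
  intro s hs ε hε
  obtain ⟨X0, hX0, H⟩ := h s hs ε hε
  refine ⟨max X0 (c₁ / 2 + (b1 / b0) * Real.log (2 * b0 / c₂) + 1), lt_of_lt_of_le hX0 (le_max_left _ _),
    fun L _ β hβ hx => ?_⟩
  by_cases hβ₁ : c₁ ≤ β
  · exact H L β hβ₁ ((le_max_left _ _).trans hx)
  · exfalso
    have hb := invRunningCoupling_le_of_cut hc₂ hβ (le_of_lt (not_le.mp hβ₁)) L
    have := (le_max_right _ _).trans hx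
    linarith

/-- ★ `X-FORM[c ≤ β] ⟺ X-FORM[1 ≤ β]` for every fixed `c > 0`: the number `1` in the guard carries no content. [folklore] -/
theorem invCouplingForm_cut_iff {c : ℝ} (hc : 0 < c) :
    (∀ s : ℝ, 0 < s → ∀ ε : ℝ, 0 < ε → ∃ X0 : ℝ, 0 < X0 ∧
      ∀ (L : ℕ) [NeZero L], ∀ β : ℝ, c ≤ β → X0 ≤ invRunningCoupling β L →
        |traceRatio L β (femtoSteps s β L) - hTraceRatio s| ≤ ε) ↔
    (∀ s : ℝ, 0 < s → ∀ ε : ℝ, 0 < ε → ∃ X0 : ℝ, 0 < X0 ∧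
      ∀ (L : ℕ) [NeZero L], ∀ β : ℝ, 1 ≤ β → X0 ≤ invRunningCoupling β L →
        |traceRatio L β (femtoSteps s β L) - hTraceRatio s| ≤ ε) :=
  ⟨invCouplingForm_cut_mono one_pos, invCouplingForm_cut_mono hc⟩

/-- ★ **… but the cut `0 < β` is not enough**: the X-FORM with guard `0 < β` is FALSE (the strong root of ✓`R75c.strongRoot_violates` has `0 < β < 1` and
`X0 ≤ 1/ḡ²(β, 1)`). [folklore] -/
theorem invCouplingForm_false_posCut :
    ¬ (∀ s : ℝ, 0 < s → ∀ ε : ℝ, 0 < ε → ∃ X0 : ℝ, 0 < X0 ∧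
        ∀ (L : ℕ) [NeZero L], ∀ β : ℝ, 0 < β → X0 ≤ invRunningCoupling β L →
          |traceRatio L β (femtoSteps s β L) - hTraceRatio s| ≤ ε) := by
  intro h
  have hg : 0 < (1 - hTraceRatio 1) / 4 := by linarith [hTraceRatio_lt_one one_pos]
  obtain ⟨X0, hX0, H⟩ := h 1 one_pos _ hg
  obtain ⟨β, hβ0, -, hpos, hle, hviol⟩ :=
    R75c.strongRoot_violates 1 (Λ0 := (X0⁻¹) ^ ((1 : ℝ) / 3)) (Real.rpow_pos_of_pos (by positivity) _)
  have hx : X0 ≤ invRunningCoupling β 1 := by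
    have h1 := R76.inv_cube_le_invRunningCoupling hpos hle
    rwa [R77.cbrt_inv_pow_three hX0, inv_inv] at h1
  exact absurd (H 1 β hβ0 hx) (not_le.mpr hviol)

/-! ## §3 ★ LIM: the same cut-independence, and the stub with any fixed positive cut -/

/-- The cut-generic conversion `LIM[c ≤ β] ⟺ X-FORM[c ≤ β]` (the proof of ✓`R76.labelLimit_iff_invCouplingForm` does not look at the guard). [cite: LuscherMunster1984, §2] -/
theorem labelLimit_iff_invCouplingForm_cut (c : ℝ) :
    (∀ s : ℝ, 0 < s → ∀ ε : ℝ, 0 < ε → ∃ Λ0 : ℝ, 0 < Λ0 ∧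
      ∀ (L : ℕ) [NeZero L], ∀ β : ℝ, c ≤ β → 0 < luscherLambda β L → luscherLambda β L ≤ Λ0 →
        |traceRatio L β (femtoSteps s β L) - hTraceRatio s| ≤ ε) ↔
    (∀ s : ℝ, 0 < s → ∀ ε : ℝ, 0 < ε → ∃ X0 : ℝ, 0 < X0 ∧
      ∀ (L : ℕ) [NeZero L], ∀ β : ℝ, c ≤ β → X0 ≤ invRunningCoupling β L →
        |traceRatio L β (femtoSteps s β L) - hTraceRatio s| ≤ ε) := by
  constructor
  · intro h s hs ε hε
    obtain ⟨Λ0, hΛ0, H⟩ := h s hs ε hε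
    refine ⟨(Λ0 ^ 3)⁻¹, by positivity, fun L _ β hβ hx => ?_⟩
    obtain ⟨hpos, hle⟩ := R76.luscherLambda_le_of_le_invRunningCoupling (by positivity) hx
    rw [R77.cbrt_inv_inv_cube hΛ0.le] at hle
    exact H L β hβ hpos hle
  · intro h s hs ε hε
    obtain ⟨X0, hX0, H⟩ := h s hs ε hε
    refine ⟨(X0⁻¹) ^ ((1 : ℝ) / 3), Real.rpow_pos_of_pos (by positivity) _, fun L _ β hβ hpos hle => ?_⟩
    refine H L β hβ ?_
    have h1 := R76.inv_cube_le_invRunningCoupling hpos hle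
    rwa [R77.cbrt_inv_pow_three hX0, inv_inv] at h1

/-- ★ `LIM[c ≤ β] ⟺ LIM` for every fixed `c > 0`. [folklore] -/
theorem labelLimit_cut_iff {c : ℝ} (hc : 0 < c) :
    (∀ s : ℝ, 0 < s → ∀ ε : ℝ, 0 < ε → ∃ Λ0 : ℝ, 0 < Λ0 ∧
      ∀ (L : ℕ) [NeZero L], ∀ β : ℝ, c ≤ β → 0 < luscherLambda β L → luscherLambda β L ≤ Λ0 →
        |traceRatio L β (femtoSteps s β L) - hTraceRatio s| ≤ ε) ↔
    (∀ s : ℝ, 0 < s → ∀ ε : ℝ, 0 < ε → ∃ Λ0 : ℝ, 0 < Λ0 ∧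
      ∀ (L : ℕ) [NeZero L], ∀ β : ℝ, 1 ≤ β → 0 < luscherLambda β L → luscherLambda β L ≤ Λ0 →
        |traceRatio L β (femtoSteps s β L) - hTraceRatio s| ≤ ε) :=
  (labelLimit_iff_invCouplingForm_cut c).trans ((invCouplingForm_cut_iff hc).trans (labelLimit_iff_invCouplingForm_cut 1).symm)

/-- ★ LIM with guard `0 < β` is FALSE (strong root). [folklore] -/
theorem labelLimit_false_posCut :
    ¬ (∀ s : ℝ, 0 < s → ∀ ε : ℝ, 0 < ε → ∃ Λ0 : ℝ, 0 < Λ0 ∧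
        ∀ (L : ℕ) [NeZero L], ∀ β : ℝ, 0 < β → 0 < luscherLambda β L → luscherLambda β L ≤ Λ0 →
          |traceRatio L β (femtoSteps s β L) - hTraceRatio s| ≤ ε) := by
  intro h
  have hg : 0 < (1 - hTraceRatio 1) / 4 := by linarith [hTraceRatio_lt_one one_pos]
  obtain ⟨Λ0, hΛ0, H⟩ := h 1 one_pos _ hg
  obtain ⟨β, hβ0, -, hpos, hle, hviol⟩ := R75c.strongRoot_violates 1 hΛ0
  exact absurd (H 1 β hβ0 hpos hle) (not_le.mpr hviol)

/-- **The registered stub ⟺ LIM with ANY fixed positive cut** (✓`R75.cmpTwoLoop_iff_labelLimit`, `labelLimit_cut_iff`). [folklore] -/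
theorem cmpTwoLoop_iff_labelLimit_cut {c : ℝ} (hc : 0 < c) :
    Stmt.stub_cmpTwoLoop ↔
    (∀ s : ℝ, 0 < s → ∀ ε : ℝ, 0 < ε → ∃ Λ0 : ℝ, 0 < Λ0 ∧
      ∀ (L : ℕ) [NeZero L], ∀ β : ℝ, c ≤ β → 0 < luscherLambda β L → luscherLambda β L ≤ Λ0 →
        |traceRatio L β (femtoSteps s β L) - hTraceRatio s| ≤ ε) :=
  R75.cmpTwoLoop_iff_labelLimit.trans (labelLimit_cut_iff hc).symm

/-- **The registered stub ⟺ the X-FORM with ANY fixed positive cut** (✓`R76.cmpTwoLoop_iff_invCouplingForm`, `invCouplingForm_cut_iff`). [folklore] -/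
theorem cmpTwoLoop_iff_invCouplingForm_cut {c : ℝ} (hc : 0 < c) :
    Stmt.stub_cmpTwoLoop ↔
    (∀ s : ℝ, 0 < s → ∀ ε : ℝ, 0 < ε → ∃ X0 : ℝ, 0 < X0 ∧
      ∀ (L : ℕ) [NeZero L], ∀ β : ℝ, c ≤ β → X0 ≤ invRunningCoupling β L →
        |traceRatio L β (femtoSteps s β L) - hTraceRatio s| ≤ ε) :=
  R76.cmpTwoLoop_iff_invCouplingForm.trans (invCouplingForm_cut_iff hc).symm

/-- **Dichotomy of the weak-coupling guard** (for the planner of a rev 4): with a fixed cut `c > 0` the X-FORM is the registered stub; with the cut `0 < β` it is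
refuted. [folklore] -/
theorem guard_dichotomy {c : ℝ} (hc : 0 < c) :
    (Stmt.stub_cmpTwoLoop ↔
      (∀ s : ℝ, 0 < s → ∀ ε : ℝ, 0 < ε → ∃ X0 : ℝ, 0 < X0 ∧
        ∀ (L : ℕ) [NeZero L], ∀ β : ℝ, c ≤ β → X0 ≤ invRunningCoupling β L →
          |traceRatio L β (femtoSteps s β L) - hTraceRatio s| ≤ ε)) ∧
    ¬ (∀ s : ℝ, 0 < s → ∀ ε : ℝ, 0 < ε → ∃ X0 : ℝ, 0 < X0 ∧
        ∀ (L : ℕ) [NeZero L], ∀ β : ℝ, 0 < β → X0 ≤ invRunningCoupling β L →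
          |traceRatio L β (femtoSteps s β L) - hTraceRatio s| ≤ ε) :=
  ⟨cmpTwoLoop_iff_invCouplingForm_cut hc, invCouplingForm_false_posCut⟩

end R78

end Summit.QuantumFields.YangMills.Theorems.TwistedTraceScaling.Negative

end
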